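import Summits.BirchSwinnertonDyer.BirchSwinnertonDyer.Theorems.InertBadSignedBranchesCccOneLawOnTypeIstarZeroPackageRigidity
import Summits.BirchSwinnertonDyer.BirchSwinnertonDyer.Theorems.InertBadSignedBranchesCccOneLawOnTypeIstarZeroCollinearMuAdmissible
import Literature.NumberTheory.EllipticCurves.Kato2004.KatoMainConjectureCMOffMu
import Literature.NumberTheory.EllipticCurves.IwasawaAlgebraLengthAwayComparisonProofs
import HarnessLib

set_option linter.dupNamespace false
set_option autoImplicit false

/-!
# `CccOneLawOnTypeIstarZero` (stmt-BirchSwinnertonDyer-19223), line `kato_perrin_riou_istar` v15 —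
# the two zeta lines compared OFF the `μ`-prime, MODULO THE INVOLUTION `ι` (kernel, from the line's own print stub)

Refill hand `leafhand-bsd-inertbadsignedbran-8` g0 (prover), 2026-08-31; DEF-FREE helper `--supports 19223 --as helper`.
Skeleton of record `Cruxes/CccOneLawOnTypeIstarZero/Lines/kato_perrin_riou_istar.lean` v15, sha16 `1c7e623d6cf61178`
(planner bsd-cm-plan g40).  Nothing here is registered, no stub is closed, nothing is asserted about the open items
19223 / 19501 / 19865 / 19867; the two published inputs (`PublishedInputsEtaUpToP` = item 19867, conjunct `.2.2.2.2.2.1` of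
the line's PRINT stub 5, and `Kato2004.BurungaleTian2026_lengthEq_offMu_of_hasCM` = conjunct `.2.2.2.1`) are HYPOTHESES.
BSD is proved for no curve.

## What this file proves (kernel) and why it matters for stubs 2c-T1 / 2c-T2

The registered stubs 2c-T1 `stub_zetaLinesProportionalIstarZero` («`(p:Λ)^a • P₁.z = (p:Λ)^b • z₁` for SOME Kobayashi package
`P₁` and SOME admissible Kato class `z₁` on the pin») and 2c-T2 («then `a = b`») compare the two zeta lines `Λ∙P.z`
(Kobayashi's `η`-class of the good twin `V`, pinned through `Col⁺`) and `Λ∙z₀` (Kato's `Ω_W`-normalised class of `W = V ⊗ η`)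
inside the SAME `𝐇¹_Γ(T_pW)`.  Hands -3 … -7 worked at the `μ`-prime `(p)` only.  AWAY from `(p)` the line's print stub ALREADY
positions BOTH lines against the dual fine Selmer module `X₀(W/ℚ_∞)` — but in the two KEYINGS of `X₀`:

* §1 (Kobayashi side, key `γ`) `lengthAt_fine_eq_lengthAt_quotient_kobayashiClass_of_ne_augIdealP` — granted 19867: for every
  package `P` on `(I, FB)` and every height-one prime `𝔮 ≠ (p)` of `Λ`, `ℓ_𝔮(X₀(FB)) = ℓ_𝔮(𝐇¹_Γ ⧸ Λ∙P.z)`.  KERNEL: Kobayashi's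
  (7.21) at `P.z` is a four-term exact `0 → 𝐇¹/Λ∙P.z → Λ/(Col⁺ P.z) → X(D) → X₀(FB) → 0`, so `(Col⁺ P.z)·char X₀ = char(𝐇¹/Λ∙P.z)·char X(D)`
  (`BurungaleTian2026.span_singleton_mul_charIdeal_eq_of_fourTermExact`); the CLOSED item 19866 (Burungale–Tian Thm. 2.6 at `η`,
  `BurungaleTian2026.evenEtaCharIdeal_eq_upToP_of_cm`) gives `(p^b)·char X(D) = (p^a)·(Col⁺ P.z)`; cancelling the non-zero principal
  ideal `(Col⁺ P.z)` (Rohrlich) leaves `char X₀·(p)^b = char(𝐇¹/Λ∙P.z)·(p)^a`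
  (`charIdeal_fine_mul_span_pow_eq`), read as local lengths at every height-one `𝔮 ∌ p` by the tree's UFD dictionary
  `Module.lengthAt_eq_of_charIdeal_mul_span_pow_eq`.  This is hand -3's `μ`-dictionary at EVERY OTHER height-one prime, and it is
  UNCONDITIONAL in the `μ`-part (19865 is not used).
* §2 (the comparison) `lengthAt_quotient_admissible_eq_lengthAt_comap_invol_quotient_kobayashiClass` — granted 19867 AND
  Burungale–Tian for `W` (`Kato2004.BurungaleTian2026_lengthEq_offMu_of_hasCM`, whose `X₀` is keyed `γ⁻¹` = Kato's `𝐇²`, the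
  CONTRAGREDIENT key): for every admissible `z₀` on the pin and every height-one `𝔮 ≠ (p)`,
  **`ℓ_𝔮(𝐇¹_Γ ⧸ Λ∙z₀) = ℓ_{ι𝔮}(𝐇¹_Γ ⧸ Λ∙P.z)`**, `ι𝔮 := (invol p)⁻¹𝔮` the involution `T ↦ (1+T)⁻¹ − 1` — the re-keying
  `γ ↦ γ⁻¹` of `X₀` is the `ι`-twist (`Kato2004.fineSelmerDualData_lengthAt_inv_eq`).  So OFF `(p)` the two zeta lines have
  characteristic ideals that are `ι`-CONJUGATE — kernel-certified from the line's existing inputs, no new named fact.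
* §3 (what 2c-T1 must therefore carry) `lengthAt_quotient_kobayashiClass_eq_comap_invol_of_proportional` /
  `lengthAt_fine_eq_comap_invol_of_proportional` — if `(p:Λ)^a • P.z = (p:Λ)^b • z₁` for ONE package and ONE admissible class
  (2c-T1's conclusion at that pair), then `char(𝐇¹_Γ ⧸ Λ∙P.z)`, `char(𝐇¹_Γ ⧸ Λ∙z₁)` and `char X₀(W/ℚ_∞)` are `ι`-INVARIANT away
  from `(p)`: `ℓ_𝔮 = ℓ_{ι𝔮}` at every height-one `𝔮 ≠ (p)`.  That `ι`-symmetry is FUNCTIONAL-EQUATION content (Greenberg 1989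
  §0 for Selmer groups; for Kato's element: `L(W, χ, 1) ↔ L(W, χ̄, 1)`), which the tree does not have: it is exactly the print
  content a typer fact for 2c-T1 must supply BEYOND what the line already cites; conversely (census of this hand, not kernel here)
  `ι`-invariance off `(p)` + `rank_Λ 𝐇¹_Γ = 1` + unique factorisation in `Λ` give 2c-T1 back.  §4 reads §3 on the rows of the
  type `(p, I₀*)`, `p ≥ 5`, with stub 2c-T1's registered sentence as a displayed hypothesis.

Honest label: bookkeeping only; closes no stub; 19223 stays OPEN.
References: [Kobayashi2003] Thm. 6.3 (p. 11), Thm. 7.3 i) (7.21), proof of Thm. 7.4 (p. 13); [BurungaleTian2026] Thm. 2.6,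
Rem. 2.7 (p. 5); [Kato2004Asterisque] Thm. 12.4 (2), Thm. 12.5 (1) (p. 221), Conj. 12.10 (p. 224), §13.9 (p. 230);
[GreenbergLNM1716] §1 (p. 60); [Greenberg1989] §0 (pp. 101–102); [Washington1997] §13.2; [NeukirchSchmidtWingberg2008] Ch. V §3.
-/

noncomputable section

open scoped Classical

open CongruenceSubgroup WeierstrassCurve Field Literature.NumberTheory.EllipticCurves
  Literature.NumberTheory.EllipticCurves.ModularForms Literature.NumberTheory.EllipticCurves.IwasawaAlgebra
  Literature.NumberTheory.EllipticCurves.Kato2004 ZpExtension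
  Summit.BirchSwinnertonDyer.BirchSwinnertonDyer.Theses.InertBadSignedBranches
  Summit.BirchSwinnertonDyer.Rank1Residual

namespace Summit.BirchSwinnertonDyer.BirchSwinnertonDyer.Theorems.CccOneOffMuComparison

variable {p : ℕ} [Fact p.Prime]

/-! ## §0 Plumbing: the height-one primes of `Λ` away from `(p)`, and their `ι`-conjugates -/

/-- For a height-one prime `𝔮` of `Λ = ℤ_p⟦T⟧`: `p ∉ 𝔮 ↔ 𝔮 ≠ (p)` (`(p)` = `IwasawaAlgebra.augIdealP p` is the only height-one
prime containing the prime element `p`). [cite: Washington1997, §13.2] -/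
theorem natCast_not_mem_iff_ne_augIdealP (𝔮 : PrimeSpectrum (IwasawaAlgebra p)) (h𝔮 : 𝔮.asIdeal.height = 1) :
    (p : IwasawaAlgebra p) ∉ 𝔮.asIdeal ↔ 𝔮.asIdeal ≠ augIdealP p := by
  rw [show (p : IwasawaAlgebra p) = PowerSeries.C (p : ℤ_[p]) from
    (map_natCast (PowerSeries.C (R := ℤ_[p])) p).symm]
  constructor
  · intro h heq
    apply h
    rw [heq]
    exact Ideal.subset_span (Set.mem_singleton _)
  · intro hne hmem
    exact hne (Ideal.eq_span_singleton_of_height_eq_one h𝔮 hmem (IwasawaAlgebra.prime_C p))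

/-- The `ι`-conjugate `ι𝔮` of a prime `𝔮 ≠ (p)` is `≠ (p)` (`ι` fixes `(p)` and is an involution). [cite: Washington1997, §13.2] -/
theorem comap_invol_ne_augIdealP (𝔮 : PrimeSpectrum (IwasawaAlgebra p)) (hne : 𝔮.asIdeal ≠ augIdealP p) :
    (PrimeSpectrum.comap (invol p).toRingHom 𝔮).asIdeal ≠ augIdealP p := by
  intro h
  have hfix := comap_invol_eq_self_of_asIdeal_eq_augIdealP p (PrimeSpectrum.comap (invol p).toRingHom 𝔮) h
  rw [Kato2004.comap_invol_comap_invol] at hfix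
  apply hne
  rw [hfix]
  exact h

/-- The `ι`-conjugate of a height-one prime has height one. [cite: Washington1997, §13.2] -/
theorem height_comap_invol_eq_one (𝔮 : PrimeSpectrum (IwasawaAlgebra p)) (h𝔮 : 𝔮.asIdeal.height = 1) :
    (PrimeSpectrum.comap (invol p).toRingHom 𝔮).asIdeal.height = 1 := by
  rw [Kato2004.height_comap_invol]
  exact h𝔮

/-! ## §0b Collinearity along `p`-powers does not move lengths away from `(p)` -/

section H1

variable {W : WeierstrassCurve ℚ} [W.IsElliptic] [ContinuousSMul ℤ_[p] (W.tateModule p)]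
  {K : ZpExtension ℚ p} {γ : absoluteGaloisGroup ℚ} (I : IwasawaH1Data W p K γ)

/-- `ℓ_𝔮 (Λ ⧸ (p^a)) = 0` at every prime `𝔮 ∌ p`. [cite: Washington1997, §13.2] -/
theorem lengthAt_quotient_span_natCast_pow_eq_zero (a : ℕ) (𝔮 : PrimeSpectrum (IwasawaAlgebra p))
    (hp𝔮 : (p : IwasawaAlgebra p) ∉ 𝔮.asIdeal) :
    Module.lengthAt (IwasawaAlgebra p) (IwasawaAlgebra p ⧸ Ideal.span {(p : IwasawaAlgebra p) ^ a}) 𝔮 = 0 := by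
  apply Module.lengthAt_quotient_eq_zero_of_not_le
  intro hle
  have hmem : (p : IwasawaAlgebra p) ^ a ∈ 𝔮.asIdeal := hle (Ideal.subset_span (Set.mem_singleton _))
  exact hp𝔮 (𝔮.isPrime.mem_of_pow_mem a hmem)

/-- **A `p`-power proportionality does not move local lengths away from `(p)`**: for non-zero `z, z₀ ∈ 𝐇¹_Γ(T_pW)` with
`(p:Λ)^a • z = (p:Λ)^b • z₀` and every prime `𝔮 ∌ p` of `Λ`, `ℓ_𝔮(𝐇¹_Γ ⧸ Λ∙z) = ℓ_𝔮(𝐇¹_Γ ⧸ Λ∙z₀)` (hand -4's collinearity identity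
`CccOneCollinearMu.lengthAt_add_eq_of_collinear` with `ℓ_𝔮(Λ/(p^a)) = ℓ_𝔮(Λ/(p^b)) = 0`).
[cite: Kato2004Asterisque, Thm. 12.4 (2) (p. 221)] [cite: Washington1997, §13.2] -/
theorem lengthAt_quotient_eq_of_pow_smul_eq_pow_smul (hγ : K.IsTopGenerator γ) {z z₀ : I.H} (hz : z ≠ 0)
    (hz₀ : z₀ ≠ 0) {a b : ℕ} (h : ((p : IwasawaAlgebra p) ^ a) • z = ((p : IwasawaAlgebra p) ^ b) • z₀)
    (𝔮 : PrimeSpectrum (IwasawaAlgebra p)) (hp𝔮 : (p : IwasawaAlgebra p) ∉ 𝔮.asIdeal) :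
    Module.lengthAt (IwasawaAlgebra p) (I.H ⧸ Submodule.span (IwasawaAlgebra p) {z}) 𝔮 =
      Module.lengthAt (IwasawaAlgebra p) (I.H ⧸ Submodule.span (IwasawaAlgebra p) {z₀}) 𝔮 := by
  have key := CccOneCollinearMu.lengthAt_add_eq_of_collinear I hγ hz hz₀ h 𝔮
  rwa [lengthAt_quotient_span_natCast_pow_eq_zero a 𝔮 hp𝔮, lengthAt_quotient_span_natCast_pow_eq_zero b 𝔮 hp𝔮,
    zero_add, zero_add] at key

end H1

/-! ## The `η`-frame of the Kobayashi package fact (items 19501 / 19865 / 19867), a curve `W` with pin `I`, a dual fine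
Selmer datum `FB` of key `γ` and a Kobayashi package `P` — section variables (as in hands -3 / -5) -/

section Frame

variable (hp : p ≠ 2) (K₀ : Type) [Field K₀] [NumberField K₀]
  [IsCyclotomicExtension {p} ℚ K₀] [(galRange (K := ℚ) K₀).Normal]
  (η : absoluteGaloisGroup ℚ →* ℤˣ) (hη : ∀ σ ∈ galRange (K := ℚ) K₀, η σ = 1) (hη1 : η ≠ 1)
  (V : WeierstrassCurve ℚ) [V.IsElliptic] [V.IsGloballyMinimal] {N : ℕ} [NeZero N]
  {f : CuspForm (Gamma0 N) 2} (hCM : V.HasCM) (hgood : V.HasGoodReductionAtPrime p)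
  (hap : V.frobeniusTrace p = 0) (hf : IsNewformOf V f) (ϖ : ℚ)
  (hϖ : if Even (p / 2) then (ϖ : ℝ) * V.realPeriodRat = plusPeriod f
    else (ϖ : ℝ) * V.imaginaryPeriodRat = minusPeriod f)
  (κ : ZpExtension ℚ p) (γ : absoluteGaloisGroup ℚ) (hκ : κ.IsCyclotomic) (hγ : κ.IsTopGenerator γ)
  (hγK : γ ∈ galRange (K := ℚ) K₀) (hvar : IsCyclotomicVariable p γ)
  (W : WeierstrassCurve ℚ) [W.IsElliptic] [ContinuousSMul ℤ_[p] (W.tateModule p)]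
  (I : Kato2004.IwasawaH1Data W p κ γ) (FB : W.FineSelmerDualData κ γ)
  (P : Kobayashi2003.EtaColemanPoitouTateData p K₀ η V f ϖ κ γ W I FB)

include hp hη hη1 hCM hgood hap hf hϖ hκ hγ hγK hvar

/-! ## §1 The Kobayashi OFF-`μ` dictionary: `char X₀(FB)·(p)^b = char(𝐇¹_Γ ⧸ Λ∙P.z)·(p)^a` (granted 19867) -/

/-- **Kobayashi's zeta line against `X₀(W/ℚ_∞)` (key `γ`), up to powers of `(p)` (kernel, granted 19867).** In the `η`-frame,
for every `W` with pin `I`, every dual fine Selmer datum `FB` of key `γ` and every Kobayashi package `P` on `(I, FB)`: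
`char X₀(FB) · (p)^b = char(𝐇¹_Γ(T_pW) ⧸ Λ∙P.z) · (p)^a` for some `a b : ℕ`.  Proof: Kobayashi's (7.21) at `P.z` is the
four-term exact `0 → 𝐇¹/Λ∙P.z → Λ/(Col⁺ P.z) → X(D) → X₀(FB) → 0` (`Thm74Skeleton.exists_fourTermExact_of_threeTermExact`), so
`(Col⁺ P.z)·char X₀ = char(𝐇¹/Λ∙P.z)·char X(D)`; Burungale–Tian Thm. 2.6 at `η` (the CLOSED item 19866 through
`BurungaleTian2026.evenEtaCharIdeal_eq_upToP_of_cm`) gives `(p^b)·char X(D) = (p^a)·(Lp)` with `(Lp) = (Col⁺ P.z)` (plus functions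
are unique up to `ℤ_pˣ`); cancel the non-zero principal ideal `(Col⁺ P.z)` (Rohrlich, `CccOnePackageRigidity.colPlus_z_ne_zero`).
[cite: Kobayashi2003, Thm. 7.3 i) (7.21) and proof of Thm. 7.4 (p. 13), Thm. 6.3 (p. 11)]
[cite: BurungaleTian2026, Thm. 2.6 (p. 5)] [cite: NeukirchSchmidtWingberg2008, Ch. V §3] -/
theorem charIdeal_fine_mul_span_pow_eq (hF : PublishedInputsEtaUpToP) :
    ∃ a b : ℕ,
      Module.charIdeal (IwasawaAlgebra p) FB.X * Ideal.span {(p : IwasawaAlgebra p)} ^ b =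
        Module.charIdeal (IwasawaAlgebra p) (I.H ⧸ Submodule.span (IwasawaAlgebra p) {P.z}) *
          Ideal.span {(p : IwasawaAlgebra p)} ^ a := by
  obtain ⟨h26, h22⟩ := hF
  -- a plus dual datum `D` of `Sel⁺(V/K_∞)^η`
  obtain ⟨Dₐ⟩ := Additive.nonempty_etaSignedSelmerDualData_cyclotomic V κ K₀ ℚ_[p] η (1 : ℤˣ) hγ hγK
  let D : Kobayashi2003.EtaSignedSelmerDualData V κ K₀ ℚ_[p] η γ 1 :=
    ⟨Dₐ.X, Dₐ.conj_mem, Dₐ.toDual, Dₐ.bijective, Dₐ.toDual_T_smul, Dₐ.toDual_C_smul⟩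
  -- 19866: `(p^b)·char X(D) = (p^a)·(Lp)` for a plus function `Lp`
  obtain ⟨Lp, hLp, hup⟩ := BurungaleTian2026.evenEtaCharIdeal_eq_upToP_of_cm h26 h22 K₀ η hη hη1 V hp hCM
    hgood hap hf ϖ hϖ κ γ hκ hγ hγK hvar
  obtain ⟨a, b, hab⟩ := hup D
  -- `(Col⁺ P.z) = (Lp)`, `Col⁺ P.z ≠ 0`
  have hspan : Ideal.span {P.colPlus P.z} = Ideal.span {Lp} :=
    Kobayashi2003.IsQuadraticBranchPlusLFunction.span_singleton_eq hp P.isPlus_colPlus_z hLp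
  have hcz : P.colPlus P.z ≠ 0 := CccOnePackageRigidity.colPlus_z_ne_zero hp K₀ η V hgood hf ϖ hϖ κ γ W I P
  change Ideal.span {(p : IwasawaAlgebra p) ^ b} * Module.charIdeal (IwasawaAlgebra p) D.X =
    Ideal.span {(p : IwasawaAlgebra p) ^ a} * Ideal.span {Lp} at hab
  rw [← hspan] at hab
  -- the four-term sequence at `P.z` and its characteristic-ideal bookkeeping
  obtain ⟨j, k, hcj, hjk, hk⟩ := P.exact_plus D
  obtain ⟨i, j', k', hi, hij, hjk', hk'⟩ :=
    Thm74Skeleton.exists_fourTermExact_of_threeTermExact P.colPlus j k P.colPlus_injective hcj hjk hk P.z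
  haveI : Module.Finite (IwasawaAlgebra p) I.H := Kato2004.IwasawaH1Data.module_finite_of_isCyclotomic hκ hγ I
  haveI : Module.Finite (IwasawaAlgebra p) FB.X := WeierstrassCurve.FineSelmerDualData.module_finite W κ hγ FB
  have h4 := BurungaleTian2026.span_singleton_mul_charIdeal_eq_of_fourTermExact P.isTorsion_fine hcz i j' k' hi
    hij hjk' hk'
  refine ⟨a, b, ?_⟩
  have key : Ideal.span {P.colPlus P.z} *
        (Module.charIdeal (IwasawaAlgebra p) FB.X * Ideal.span {(p : IwasawaAlgebra p) ^ b}) =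
      Ideal.span {P.colPlus P.z} *
        (Module.charIdeal (IwasawaAlgebra p) (I.H ⧸ Submodule.span (IwasawaAlgebra p) {P.z}) *
          Ideal.span {(p : IwasawaAlgebra p) ^ a}) := by
    calc Ideal.span {P.colPlus P.z} *
          (Module.charIdeal (IwasawaAlgebra p) FB.X * Ideal.span {(p : IwasawaAlgebra p) ^ b})
        = (Ideal.span {P.colPlus P.z} * Module.charIdeal (IwasawaAlgebra p) FB.X) *
            Ideal.span {(p : IwasawaAlgebra p) ^ b} := by ring
      _ = Module.charIdeal (IwasawaAlgebra p) (I.H ⧸ Submodule.span (IwasawaAlgebra p) {P.z}) *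
            (Ideal.span {(p : IwasawaAlgebra p) ^ b} * Module.charIdeal (IwasawaAlgebra p) D.X) := by
          rw [h4]; ring
      _ = Module.charIdeal (IwasawaAlgebra p) (I.H ⧸ Submodule.span (IwasawaAlgebra p) {P.z}) *
            (Ideal.span {(p : IwasawaAlgebra p) ^ a} * Ideal.span {P.colPlus P.z}) := by rw [hab]
      _ = Ideal.span {P.colPlus P.z} *
            (Module.charIdeal (IwasawaAlgebra p) (I.H ⧸ Submodule.span (IwasawaAlgebra p) {P.z}) *
              Ideal.span {(p : IwasawaAlgebra p) ^ a}) := by ring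
  rw [Ideal.span_singleton_pow, Ideal.span_singleton_pow]
  exact (Ideal.span_singleton_mul_right_inj hcz).mp key

/-- **The Kobayashi OFF-`μ` dictionary (kernel, granted 19867): `ℓ_𝔮(X₀(FB)) = ℓ_𝔮(𝐇¹_Γ(T_pW) ⧸ Λ∙P.z)` at every height-one
prime `𝔮 ≠ (p)`** — hand -3's `μ`-dictionary `CccOneMuDictionaryEta.lengthAt_fine_eq_lengthAt_quotient_of_plusMCEtaKMuPart` at every
OTHER height-one prime, WITHOUT the `μ`-part 19865 (both modules are finitely generated torsion, and §1's ideal identity is read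
prime by prime by the UFD dictionary `Module.lengthAt_eq_of_charIdeal_mul_span_pow_eq`).
[cite: Kobayashi2003, proof of Thm. 7.4 (p. 13)] [cite: BurungaleTian2026, Thm. 2.6 (p. 5)] [cite: Washington1997, §13.2] -/
theorem lengthAt_fine_eq_lengthAt_quotient_kobayashiClass_of_ne_augIdealP (hF : PublishedInputsEtaUpToP)
    (𝔮 : PrimeSpectrum (IwasawaAlgebra p)) (h𝔮 : 𝔮.asIdeal.height = 1) (hne : 𝔮.asIdeal ≠ augIdealP p) :
    Module.lengthAt (IwasawaAlgebra p) FB.X 𝔮 =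
      Module.lengthAt (IwasawaAlgebra p) (I.H ⧸ Submodule.span (IwasawaAlgebra p) {P.z}) 𝔮 := by
  obtain ⟨a, b, hab⟩ := charIdeal_fine_mul_span_pow_eq hp K₀ η hη hη1 V hCM hgood hap hf ϖ hϖ κ γ hκ hγ hγK hvar W I
    FB P hF
  have hcz : P.colPlus P.z ≠ 0 := CccOnePackageRigidity.colPlus_z_ne_zero hp K₀ η V hgood hf ϖ hϖ κ γ W I P
  haveI : Module.Finite (IwasawaAlgebra p) I.H := Kato2004.IwasawaH1Data.module_finite_of_isCyclotomic hκ hγ I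
  haveI : Module.Finite (IwasawaAlgebra p) FB.X := WeierstrassCurve.FineSelmerDualData.module_finite W κ hγ FB
  have hAt : Module.IsTorsion (IwasawaAlgebra p) (I.H ⧸ Submodule.span (IwasawaAlgebra p) {P.z}) :=
    CccOneMuDictionaryEta.isTorsion_quotient_span_of_injective_of_ne_zero P.colPlus P.colPlus_injective hcz
  exact Module.lengthAt_eq_of_charIdeal_mul_span_pow_eq P.isTorsion_fine hAt hab 𝔮 h𝔮
    ((natCast_not_mem_iff_ne_augIdealP 𝔮 h𝔮).mpr hne)

/-! ## §2 The two zeta lines OFF `(p)`, modulo `ι` (granted 19867 and Burungale–Tian for `W`) -/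

/-- **The admissible Kato line and the Kobayashi line have `ι`-CONJUGATE characteristic ideals away from `(p)` (kernel).**
In the `η`-frame, for a CM curve `W` (globally minimal) with pin `I`, a Kobayashi package `P` on `(I, FB)`, an ADMISSIBLE Kato
class `z₀ ∈ 𝐇¹_Γ(T_pW)` on `I`, and every height-one prime `𝔮 ≠ (p)` of `Λ`:
`ℓ_𝔮(𝐇¹_Γ ⧸ Λ∙z₀) = ℓ_{ι𝔮}(𝐇¹_Γ ⧸ Λ∙P.z)`, `ι𝔮 = (invol p)⁻¹𝔮`.  Chain: Burungale–Tian for `W` (`X₀` of the CONTRAGREDIENT key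
`γ⁻¹`): `ℓ_𝔮(X₀(Y)) = ℓ_𝔮(𝐇¹/Λ∙z₀)`; the re-keying `γ⁻¹ ↦ γ` is the `ι`-twist: `ℓ_𝔮(X₀(Y)) = ℓ_{ι𝔮}(X₀(FB))`
(`Kato2004.fineSelmerDualData_lengthAt_inv_eq`); §1 at `ι𝔮` (height one, `≠ (p)`).
[cite: BurungaleTian2026, Thm. 2.6 (p. 5)] [cite: Kato2004Asterisque, Conj. 12.10 (p. 224), §13.9 (p. 230)]
[cite: Kobayashi2003, proof of Thm. 7.4 (p. 13)] [cite: GreenbergLNM1716, §1 (p. 60)] -/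
theorem lengthAt_quotient_admissible_eq_lengthAt_comap_invol_quotient_kobayashiClass [W.IsGloballyMinimal]
    (hBT : Kato2004.BurungaleTian2026_lengthEq_offMu_of_hasCM) (hF : PublishedInputsEtaUpToP) (hWCM : W.HasCM)
    (z₀ : I.H) (hz₀ : IsAdmissibleZetaClass W p κ hκ I z₀)
    (𝔮 : PrimeSpectrum (IwasawaAlgebra p)) (h𝔮 : 𝔮.asIdeal.height = 1) (hne : 𝔮.asIdeal ≠ augIdealP p) :
    Module.lengthAt (IwasawaAlgebra p) (I.H ⧸ Submodule.span (IwasawaAlgebra p) {z₀}) 𝔮 =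
      Module.lengthAt (IwasawaAlgebra p) (I.H ⧸ Submodule.span (IwasawaAlgebra p) {P.z})
        (PrimeSpectrum.comap (invol p).toRingHom 𝔮) := by
  obtain ⟨Y⟩ := W.nonempty_fineSelmerDualData' (κ := κ) γ⁻¹
  have hB := hBT W p κ γ hκ hγ hp hWCM I z₀ hz₀ Y 𝔮 h𝔮 hne
  rw [← hB, Kato2004.fineSelmerDualData_lengthAt_inv_eq FB Y 𝔮]
  exact lengthAt_fine_eq_lengthAt_quotient_kobayashiClass_of_ne_augIdealP hp K₀ η hη hη1 V hCM hgood hap hf ϖ hϖ κ γ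
    hκ hγ hγK hvar W I FB P hF _ (height_comap_invol_eq_one 𝔮 h𝔮) (comap_invol_ne_augIdealP 𝔮 hne)

/-! ## §3 What a `p`-power proportionality of the two lines forces: `ι`-invariance away from `(p)` -/

/-- **Stub 2c-T1's proportionality at ONE pair forces the `ι`-symmetry of Kobayashi's line off `(p)` (kernel).** Same frame;
if `(p:Λ)^a • P.z = (p:Λ)^b • z₁` for an admissible `z₁` on the pin (the registered conclusion of `stub_zetaLinesProportionalIstarZero`
at `(FB, P, z₁, a, b)`), then `ℓ_𝔮(𝐇¹_Γ ⧸ Λ∙P.z) = ℓ_{ι𝔮}(𝐇¹_Γ ⧸ Λ∙P.z)` at every height-one `𝔮 ≠ (p)`: §0b (the proportionality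
does not move lengths off `(p)`) + §2.  Both classes are non-zero (Rohrlich: `CccOnePackageRigidity.colPlus_z_ne_zero`,
`CccOneCollinearMu.ne_zero_of_isAdmissibleZetaClass`). [cite: Kato2004Asterisque, Thm. 12.4 (2), Thm. 12.5 (1) (p. 221)]
[cite: Kobayashi2003, Thm. 6.3 (p. 11)] [cite: Greenberg1989, §0 (pp. 101–102)] -/
theorem lengthAt_quotient_kobayashiClass_eq_comap_invol_of_proportional [W.IsGloballyMinimal]
    (hBT : Kato2004.BurungaleTian2026_lengthEq_offMu_of_hasCM) (hF : PublishedInputsEtaUpToP) (hWCM : W.HasCM)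
    (z₁ : I.H) (hz₁ : IsAdmissibleZetaClass W p κ hκ I z₁) {a b : ℕ}
    (hT1 : ((p : IwasawaAlgebra p) ^ a) • P.z = ((p : IwasawaAlgebra p) ^ b) • z₁)
    (𝔮 : PrimeSpectrum (IwasawaAlgebra p)) (h𝔮 : 𝔮.asIdeal.height = 1) (hne : 𝔮.asIdeal ≠ augIdealP p) :
    Module.lengthAt (IwasawaAlgebra p) (I.H ⧸ Submodule.span (IwasawaAlgebra p) {P.z}) 𝔮 =
      Module.lengthAt (IwasawaAlgebra p) (I.H ⧸ Submodule.span (IwasawaAlgebra p) {P.z})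
        (PrimeSpectrum.comap (invol p).toRingHom 𝔮) := by
  have hcz : P.colPlus P.z ≠ 0 := CccOnePackageRigidity.colPlus_z_ne_zero hp K₀ η V hgood hf ϖ hϖ κ γ W I P
  have hPz : P.z ≠ 0 := by
    intro h0
    exact hcz (by rw [h0, map_zero])
  have hz₁0 : z₁ ≠ 0 := CccOneCollinearMu.ne_zero_of_isAdmissibleZetaClass I hγ hz₁
  rw [lengthAt_quotient_eq_of_pow_smul_eq_pow_smul I hγ hPz hz₁0 hT1 𝔮
    ((natCast_not_mem_iff_ne_augIdealP 𝔮 h𝔮).mpr hne)]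
  exact lengthAt_quotient_admissible_eq_lengthAt_comap_invol_quotient_kobayashiClass hp K₀ η hη hη1 V hCM hgood hap hf
    ϖ hϖ κ γ hκ hγ hγK hvar W I FB P hBT hF hWCM z₁ hz₁ 𝔮 h𝔮 hne

/-- **… and the `ι`-symmetry of the ADMISSIBLE line off `(p)`**: under the same proportionality,
`ℓ_𝔮(𝐇¹_Γ ⧸ Λ∙z₁) = ℓ_{ι𝔮}(𝐇¹_Γ ⧸ Λ∙z₁)` at every height-one `𝔮 ≠ (p)` — the functional-equation symmetry of Kato's zeta line
`Z(f_W) ⊗ ℚ` on the trivial component. [cite: Kato2004Asterisque, Thm. 12.5 (1) (p. 221), Conj. 12.10 (p. 224)]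
[cite: Greenberg1989, §0 (pp. 101–102)] -/
theorem lengthAt_quotient_admissible_eq_comap_invol_of_proportional [W.IsGloballyMinimal]
    (hBT : Kato2004.BurungaleTian2026_lengthEq_offMu_of_hasCM) (hF : PublishedInputsEtaUpToP) (hWCM : W.HasCM)
    (z₁ : I.H) (hz₁ : IsAdmissibleZetaClass W p κ hκ I z₁) {a b : ℕ}
    (hT1 : ((p : IwasawaAlgebra p) ^ a) • P.z = ((p : IwasawaAlgebra p) ^ b) • z₁)
    (𝔮 : PrimeSpectrum (IwasawaAlgebra p)) (h𝔮 : 𝔮.asIdeal.height = 1) (hne : 𝔮.asIdeal ≠ augIdealP p) :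
    Module.lengthAt (IwasawaAlgebra p) (I.H ⧸ Submodule.span (IwasawaAlgebra p) {z₁}) 𝔮 =
      Module.lengthAt (IwasawaAlgebra p) (I.H ⧸ Submodule.span (IwasawaAlgebra p) {z₁})
        (PrimeSpectrum.comap (invol p).toRingHom 𝔮) := by
  have hcz : P.colPlus P.z ≠ 0 := CccOnePackageRigidity.colPlus_z_ne_zero hp K₀ η V hgood hf ϖ hϖ κ γ W I P
  have hPz : P.z ≠ 0 := by
    intro h0
    exact hcz (by rw [h0, map_zero])
  have hz₁0 : z₁ ≠ 0 := CccOneCollinearMu.ne_zero_of_isAdmissibleZetaClass I hγ hz₁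
  have hp𝔮 : (p : IwasawaAlgebra p) ∉ 𝔮.asIdeal := (natCast_not_mem_iff_ne_augIdealP 𝔮 h𝔮).mpr hne
  have hpι𝔮 : (p : IwasawaAlgebra p) ∉ (PrimeSpectrum.comap (invol p).toRingHom 𝔮).asIdeal :=
    (natCast_not_mem_iff_ne_augIdealP _ (height_comap_invol_eq_one 𝔮 h𝔮)).mpr (comap_invol_ne_augIdealP 𝔮 hne)
  rw [← lengthAt_quotient_eq_of_pow_smul_eq_pow_smul I hγ hPz hz₁0 hT1 𝔮 hp𝔮,
    ← lengthAt_quotient_eq_of_pow_smul_eq_pow_smul I hγ hPz hz₁0 hT1 _ hpι𝔮]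
  exact lengthAt_quotient_kobayashiClass_eq_comap_invol_of_proportional hp K₀ η hη hη1 V hCM hgood hap hf ϖ hϖ κ γ hκ
    hγ hγK hvar W I FB P hBT hF hWCM z₁ hz₁ hT1 𝔮 h𝔮 hne

/-- **… and the `ι`-symmetry of `char X₀(W/ℚ_∞)` off `(p)`**: under the same proportionality,
`ℓ_𝔮(X₀(FB)) = ℓ_{ι𝔮}(X₀(FB))` at every height-one `𝔮 ≠ (p)` (§1 on both sides of the previous identity) — Greenberg's
`ι`-symmetry for the dual fine Selmer module away from `p`, which is therefore PART OF THE CONTENT of stub 2c-T1 on this line.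
[cite: Greenberg1989, §0 (pp. 101–102)] [cite: GreenbergLNM1716, §1 (p. 60)] [cite: Kobayashi2003, proof of Thm. 7.4 (p. 13)] -/
theorem lengthAt_fine_eq_comap_invol_of_proportional [W.IsGloballyMinimal]
    (hBT : Kato2004.BurungaleTian2026_lengthEq_offMu_of_hasCM) (hF : PublishedInputsEtaUpToP) (hWCM : W.HasCM)
    (z₁ : I.H) (hz₁ : IsAdmissibleZetaClass W p κ hκ I z₁) {a b : ℕ}
    (hT1 : ((p : IwasawaAlgebra p) ^ a) • P.z = ((p : IwasawaAlgebra p) ^ b) • z₁)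
    (𝔮 : PrimeSpectrum (IwasawaAlgebra p)) (h𝔮 : 𝔮.asIdeal.height = 1) (hne : 𝔮.asIdeal ≠ augIdealP p) :
    Module.lengthAt (IwasawaAlgebra p) FB.X 𝔮 =
      Module.lengthAt (IwasawaAlgebra p) FB.X (PrimeSpectrum.comap (invol p).toRingHom 𝔮) := by
  rw [lengthAt_fine_eq_lengthAt_quotient_kobayashiClass_of_ne_augIdealP hp K₀ η hη hη1 V hCM hgood hap hf ϖ hϖ κ γ hκ hγ
      hγK hvar W I FB P hF 𝔮 h𝔮 hne,
    lengthAt_fine_eq_lengthAt_quotient_kobayashiClass_of_ne_augIdealP hp K₀ η hη hη1 V hCM hgood hap hf ϖ hϖ κ γ hκ hγ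
      hγK hvar W I FB P hF _ (height_comap_invol_eq_one 𝔮 h𝔮) (comap_invol_ne_augIdealP 𝔮 hne)]
  exact lengthAt_quotient_kobayashiClass_eq_comap_invol_of_proportional hp K₀ η hη hη1 V hCM hgood hap hf ϖ hϖ κ γ hκ
    hγ hγK hvar W I FB P hBT hF hWCM z₁ hz₁ hT1 𝔮 h𝔮 hne

end Frame

/-! ## §4 On the rows of the type `(p, I₀*)`, `p ≥ 5`: stub 2c-T1's sentence at a pin forces the `ι`-symmetry of
`X₀(W/ℚ_∞)` away from `(p)` -/

open Summit.BirchSwinnertonDyer.Rank1Residual.X12.O10 in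
/-- **Row reading (kernel).** On a row `(W, p)` of the signed type `(p, I₀*)`, `p ≥ 5` (so `W` has CM: `hTy.1`), in every
`η`-frame of the Kobayashi package fact and at every pin `I : 𝐇¹_Γ(T_pW)`: IF stub 2c-T1's registered conclusion holds at `I`
(`∃ FB₁ P₁ z₁ a b, IsAdmissibleZetaClass … z₁ ∧ (p:Λ)^a • P₁.z = (p:Λ)^b • z₁` — the pointwise instance of
`KatoPerrinRiouIstar.stub_zetaLinesProportionalIstarZero`), THEN, granted the line's print conjuncts BT26-for-`W` (`.2.2.2.1`) and 19867
(`.2.2.2.2.2.1`), EVERY dual fine Selmer datum `FB` of key `γ` has `ℓ_𝔮(X₀(FB)) = ℓ_{ι𝔮}(X₀(FB))` at every height-one `𝔮 ≠ (p)`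
(all key-`γ` data are `Λ`-isomorphic, `FineSelmerDualData.nonempty_linearEquiv`).  So on this line stub 2c-T1 CONTAINS Greenberg's
`ι`-symmetry of `char X₀(W/ℚ_∞) ⊗ ℚ` — print content not in the tree (census of this hand).
[cite: Greenberg1989, §0 (pp. 101–102)] [cite: Kobayashi2003, proof of Thm. 7.4 (p. 13)] [cite: BurungaleTian2026, Thm. 2.6 (p. 5)]
[cite: Kato2004Asterisque, Conj. 12.10 (p. 224)] -/
theorem lengthAt_fine_eq_comap_invol_onType_IstarZero_of_stub2cT1_at
    (hBT : Kato2004.BurungaleTian2026_lengthEq_offMu_of_hasCM) (hF : PublishedInputsEtaUpToP)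
    (p : ℕ) [Fact p.Prime] (hp5 : 5 ≤ p) (W : WeierstrassCurve ℚ) [W.IsElliptic] [W.IsGloballyMinimal]
    (hTy : HasSignedLocalType W p (.Istar 0))
    (K₀ : Type) [Field K₀] [NumberField K₀] [IsCyclotomicExtension {p} ℚ K₀] [(galRange (K := ℚ) K₀).Normal]
    (η : absoluteGaloisGroup ℚ →* ℤˣ) (hη : ∀ σ ∈ galRange (K := ℚ) K₀, η σ = 1) (hη1 : η ≠ 1)
    (V : WeierstrassCurve ℚ) [V.IsElliptic] [V.IsGloballyMinimal] {N : ℕ} [NeZero N]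
    {f : CuspForm (Gamma0 N) 2} (hCM : V.HasCM) (hgood : V.HasGoodReductionAtPrime p)
    (hap : V.frobeniusTrace p = 0) (hf : IsNewformOf V f) (ϖ : ℚ)
    (hϖ : if Even (p / 2) then (ϖ : ℝ) * V.realPeriodRat = plusPeriod f
      else (ϖ : ℝ) * V.imaginaryPeriodRat = minusPeriod f)
    (κ : ZpExtension ℚ p) (hκ : κ.IsCyclotomic) (γ : absoluteGaloisGroup ℚ) (hγ : κ.IsTopGenerator γ)
    (hγK : γ ∈ galRange (K := ℚ) K₀) (hvar : IsCyclotomicVariable p γ) :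
    letI : ContinuousSMul ℤ_[p] (W.tateModule p) := TateModule.continuousSMul_padicInt
    ∀ (I : Kato2004.IwasawaH1Data W p κ γ),
      (∃ (FB₁ : W.FineSelmerDualData κ γ) (P₁ : Kobayashi2003.EtaColemanPoitouTateData p K₀ η V f ϖ κ γ W I FB₁)
          (z₁ : I.H) (a b : ℕ), Kato2004.IsAdmissibleZetaClass W p κ hκ I z₁ ∧
            ((p : IwasawaAlgebra p) ^ a) • P₁.z = ((p : IwasawaAlgebra p) ^ b) • z₁) →
      ∀ (FB : W.FineSelmerDualData κ γ) (𝔮 : PrimeSpectrum (IwasawaAlgebra p)), 𝔮.asIdeal.height = 1 →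
        𝔮.asIdeal ≠ augIdealP p →
          Module.lengthAt (IwasawaAlgebra p) FB.X 𝔮 =
            Module.lengthAt (IwasawaAlgebra p) FB.X (PrimeSpectrum.comap (invol p).toRingHom 𝔮) := by
  intro I hT1 FB 𝔮 h𝔮 hne
  letI : ContinuousSMul ℤ_[p] (W.tateModule p) := TateModule.continuousSMul_padicInt
  have hp2 : p ≠ 2 := by omega
  obtain ⟨FB₁, P₁, z₁, a, b, hz₁, hab⟩ := hT1
  obtain ⟨e⟩ := WeierstrassCurve.FineSelmerDualData.nonempty_linearEquiv FB FB₁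
  rw [Module.lengthAt_eq_of_linearEquiv e 𝔮, Module.lengthAt_eq_of_linearEquiv e _]
  exact lengthAt_fine_eq_comap_invol_of_proportional hp2 K₀ η hη hη1 V hCM hgood hap hf ϖ hϖ κ γ hκ hγ hγK hvar W I
    FB₁ P₁ hBT hF hTy.1 z₁ hz₁ hab 𝔮 h𝔮 hne

end Summit.BirchSwinnertonDyer.BirchSwinnertonDyer.Theorems.CccOneOffMuComparison

end
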